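import Mathlib.Analysis.SpecialFunctions.Pow.Real
import Mathlib.Analysis.Complex.Basic
import Mathlib.FieldTheory.IsAlgClosed.Basic
import Literature.Computability.AlgebraicComplexity.AsymptoticSpectrum
import Literature.Computability.AlgebraicComplexity.DegenerationSpectralMonotone
import HarnessLib

/-!
# Every `3 × 3 × 3` tensor has asymptotic rank at most `3 + 2^{ω/3}` (Alman–Li 2026, Cor. 4.1)

Topic `Literature/Computability/AlgebraicComplexity`. Grounds (as the nearest printed bound; it does
NOT imply them) the cruxes
`Summit.MatrixMultiplication.MatrixMultiplication.Theses.HessianPlane.PlaneUniformFour`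
(stmt-MatrixMultiplication-4894: asymptotic rank `≤ 4` at every point of the Hessian/Cartan plane of
`3 × 3 × 3` tensors) and `…HessianPlane.HessianPlaneFlat` (stmt-4891, `≤ 3`).

J. Alman, B. Li, *Asymptotic Rank Speedup Theorems, Revisited* (arXiv:2605.21738, 20 May 2026),
read from the held text `paper:arxiv-2605.21738` (chunks p0008–p0010):

* §3.1 (p0008): "Fix a base field `𝔽`. … The asymptotic rank … `R̃(T) = lim_n R(T^{⊗n})^{1/n}` …
  By Fekete's lemma … the `lim` can also be replaced by `inf_{n ≥ 1}` … the matrix multiplication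
  exponent `ω` is characterized by `R̃(⟨n,n,n⟩) = n^ω`."  — the tree's
  `Literature.Computability.AlgebraicComplexity.asymptoticRank` (defined as that infimum) and
  `Literature.Computability.AlgebraicComplexity.omega 𝔽` (Bläser's `inf {β | R(⟨n,n,n⟩) = O(n^β)}`).
* **Proposition 4.3** (p0009): "Suppose `𝔽` is an algebraically closed field. For any `3 × 3 × 3`
  tensor `T`, we have `T ⊴ ⟨3⟩ ⊕ ⟨1,2,1⟩`."  Here (§3.1, p0008) `⟨n⟩ = Σ_{i≤n} x_i y_i z_i` is the
  tree's `unitTensor F n`, `⟨n,m,p⟩ = Σ_{i≤n, j≤m, k≤p} x_{ij} y_{jk} z_{ki}`, so `⟨1,2,1⟩ =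
  Σ_{j≤2} x_{1j} y_{j1} z_{11}` has format `2 × 2 × 1` with the summation index shared by modes 1 and
  2 — literally the tree's `matMulTensor F 2 1 1 = Σ_κ e_{κ1} ⊗ e_{κ1} ⊗ e_{11}` (Bläser's indexing
  `⟨k,m,n⟩ = Σ e_{κν} ⊗ e_{κμ} ⊗ e_{μν}`); `⊕` is `directSumTensor`; and the paper's degeneration
  `T ⊴ S` ("a one-parameter family `A_λ, B_λ, C_λ` (with entries rational in `λ`) such that
  `(A_λ ⊗ B_λ ⊗ C_λ)S = T + O(λ)`", §3.1) is, after clearing denominators, BCS's degeneration of some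
  order `q` over `F[λ]`, the tree's `AlgDegeneratesTo S T` (`DegenerationSpectralMonotone.lean`,
  BCS (15.19)–(15.20)).
* **Corollary 4.1** (p0010): "Any `3 × 3 × 3` tensor `T` has `R̃(T) ≤ 3 + 2^{ω/3}`."  Proof there:
  asymptotic rank is invariant under field extension [BCS], so assume `𝔽` algebraically closed;
  Prop. 4.3 in the three mode orders + Prop. 4.4 (`T ⊴ ⟨r⟩ ⊕ ⟨s,1,1⟩, ⟨r⟩ ⊕ ⟨1,s,1⟩, ⟨r⟩ ⊕ ⟨1,1,s⟩
  ⇒ R̃(T) ≤ r + s^{ω/3}`, Strassen duality). Remark after the proof: "Previously … the upper bound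
  on `R̃(T)` for a generic `3 × 3 × 3` tensor `T` was `5`, which is the generic rank … Numerically,
  using the current upper bound for `ω`, we have `3 + 2^{ω/3} < 4.7297`."

* `AlmanLi2026_prop43` — the named fact Prop. 4.3 (algebraically closed base field).
* `AlmanLi2026_cor41` — the named fact Cor. 4.1, over every field, format `Fin 3 × Fin 3 × Fin 3`.
* `AlmanLi2026_cor41.complex` — proved specialisation to `ℂ` (the field of the routes).

## References

* J. Alman, B. Li, *Asymptotic Rank Speedup Theorems, Revisited*, arXiv:2605.21738 (2026),
  Prop. 4.3, Prop. 4.4, Cor. 4.1. [AlmanLi2026]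
* P. Bürgisser, M. Clausen, M. A. Shokrollahi, *Algebraic Complexity Theory*, Springer (1997),
  §15 (invariance of `R̃` under field extension, cited by the proof). [BurgisserClausenShokrollahi1997]
-/

noncomputable section

namespace Literature.Computability.AlgebraicComplexity

/-- **Alman–Li 2026, Proposition 4.3** ("toy degeneration"): over an algebraically closed field `F`,
every tensor `T ∈ F³ ⊗ F³ ⊗ F³` is a degeneration of `⟨3⟩ ⊕ ⟨1,2,1⟩` — in the tree's terms
`AlgDegeneratesTo (⟨3⟩ ⊕ ⟨2,1,1⟩_Bläser) T`, the second summand being the paper's `⟨1,2,1⟩ =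
Σ_{j≤2} x_{1j} ⊗ y_{j1} ⊗ z_{11}` (format `2 × 2 × 1`, index shared by modes 1 and 2), which is the
tree's `matMulTensor F 2 1 1`. Printed proof: degeneration = membership in the Zariski closure of the
restriction locus, so it suffices to restrict a GENERIC `T`: with nonsingular `z₁`-slice `Σ x_i y_i` and
diagonalised `z₂`-slice, `T = Σ_i x_i y_i (z₁ + α_i z₂ + λ z₃) + x(M − λI)y·z₃` for an eigenvalue `λ`
of `M`, the first sum a restriction of `⟨3⟩`, the second (a rank-`≤ 2` matrix times `z₃`) of `⟨1,2,1⟩`.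
The other two mode placements of the small matrix tensor follow by relabelling the modes of `T`
(proof of Cor. 4.1). [cite: AlmanLi2026, Proposition 4.3] -/
def AlmanLi2026_prop43 : Prop :=
  ∀ (F : Type) [Field F] [IsAlgClosed F] (T : Fin 3 → Fin 3 → Fin 3 → F),
    AlgDegeneratesTo (directSumTensor (unitTensor F 3) (matMulTensor F 2 1 1)) T

/-- **Alman–Li 2026, Corollary 4.1**: over any base field `𝔽`, every tensor
`T ∈ 𝔽³ ⊗ 𝔽³ ⊗ 𝔽³` has asymptotic rank `R̃(T) ≤ 3 + 2^{ω/3}`, `ω = ω(𝔽)` the exponent of matrix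
multiplication (numerically `< 4.7297` with the 2026 bound on `ω`; previously only the generic rank
`5` was known at a generic point). Grounds — as nearest prior art, strictly weaker —
`Summit.MatrixMultiplication.MatrixMultiplication.Theses.HessianPlane.PlaneUniformFour` (`R̃ ≤ 4` on
the Cartan plane) and `.HessianPlaneFlat` (`R̃ ≤ 3`).
[cite: AlmanLi2026, Corollary 4.1] -/
def AlmanLi2026_cor41 : Prop :=
  ∀ (F : Type) [Field F] (T : Fin 3 → Fin 3 → Fin 3 → F),
    asymptoticRank T ≤ 3 + (2 : ℝ) ^ (omega F / 3)

/-- The complex case of Cor. 4.1 (the routes' field): every `T : Fin 3 → Fin 3 → Fin 3 → ℂ` has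
`R̃(T) ≤ 3 + 2^{ω(ℂ)/3}`. [cite: AlmanLi2026, Corollary 4.1] -/
theorem AlmanLi2026_cor41.complex (h : AlmanLi2026_cor41) (T : Fin 3 → Fin 3 → Fin 3 → ℂ) :
    asymptoticRank T ≤ 3 + (2 : ℝ) ^ (omega ℂ / 3) :=
  h ℂ T

end Literature.Computability.AlgebraicComplexity

end
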